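import Summits.Ventures.PercRepro.RankLevelSetRuleQModelMemCount
import Summits.Ventures.PercRepro.RankLevelSetRuleQModelIndex
import Summits.Ventures.PercRepro.RankLevelSetRuleQModelY

/-!
# PercRepro — THE MODEL IDENTITY `recv(Z) = R̂(q, k, m)` (night-1, gen 14; step 7 of `ModelRecvEq`)

On `T_{q+k}(U_{q,F} ⊕ U_{E∖F,E∖F})` with `#E = (q+k) + q`, `#F = q + m` (`m ≤ q`), a `q`-subset `Z` of `F` receives under Rule Q
exactly `R̂(q, k, m)`: the `Y`-sets above `Z` are the index sets (RuleQModelY), each of type `(a, j)` contains `m̂(q, m; a, j)`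
members (RuleQModelMemCount), there are `C(m, a)·C(q+k−m, j)` of each type (RuleQModelIndex), and the sum regroups by type.
* **`modelMatroid_ruleQRecv_eq`** — the identity;
* **`modelRecvEq`** — the Prop `ModelRecvEq` of RankLevelSetRuleQModel, PROVED; hence
* **`not_ruleQUp_model`** — Rule Q fails at the tight layer of the cell `(86, 72)` on an explicit finite matroid (with p4's
  kernel witness `rhat_lt_phiK_72_14_66`): the unconditional kernel refutation of Rule Q as a universal mechanism.
Axioms: standard.
-/

namespace PercRepro

open Set

variable {α : Type}

/-- **The model identity**: `recv(Z) = R̂(q, k, #F − q)` for a `q`-subset `Z` of the flat `F`. -/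
theorem modelMatroid_ruleQRecv_eq {E F Z : Set α} (hE : E.Finite) (hF : F ⊆ E) {q k : ℕ} (hk : 2 ≤ k)
    (hEcard : E.ncard = (q + k) + q) (hF2 : F.ncard ≤ 2 * q) (hFq : q ≤ F.ncard) (hZF : Z ⊆ F) (hZq : Z.ncard = q) :
    @ruleQRecv α (modelMatroid hE F q (q + k)) (modelMatroid_finite hE F q (q + k)) (q + k) q Z
      = rhat q k (F.ncard - q) := by
  classical
  set M := modelMatroid hE F q (q + k) with hM
  haveI : M.Finite := modelMatroid_finite hE F q (q + k)
  set m := F.ncard - q with hm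
  have hqp : q < q + k := by omega
  have hFfin : F.Finite := hE.subset hF
  have hN : (E \ F).ncard = q + k - m := by
    rw [Set.ncard_sdiff hF hFfin]
    omega
  -- the index sets above Z as a Finset: the Y-sets containing Z
  set Yfin := (cellY_finite M (q + k) q).toFinset with hYfin
  set Tfin := Yfin.filter (fun S => Z ⊆ S) with hTfin
  have hmem : ∀ S, S ∈ Tfin ↔ (Z ⊆ S ∧ S ⊆ E ∧ 1 ≤ (S \ F).ncard ∧ (S \ F).ncard ≤ q + k - q - 1) := by
    intro S
    rw [hTfin, Finset.mem_filter, hYfin, Set.Finite.mem_toFinset]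
    constructor
    · rintro ⟨hSY, hZS⟩
      have := (modelMatroid_mem_cellY_iff_of_subset hE hF hqp hZF hZq hZS).1 hSY
      exact ⟨hZS, this⟩
    · rintro ⟨hZS, hS⟩
      exact ⟨(modelMatroid_mem_cellY_iff_of_subset hE hF hqp hZF hZq hZS).2 hS, hZS⟩
  -- Step A: the indicator sum is the sum over Tfin
  have hA : @ruleQRecv α M _ (q + k) q Z = ∑ S ∈ Tfin, 1 / (memCount M (q + k) q S : ℚ) := by
    unfold ruleQRecv
    rw [hTfin, Finset.sum_filter]
    apply Finset.sum_congr rfl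
    intro S _
    rw [Set.indicator_apply]
    simp only [Set.mem_setOf_eq]
  -- Step B: memCount = m̂ on Tfin
  have hB : ∀ S ∈ Tfin, (memCount M (q + k) q S : ℚ) = (mhat q m ((S ∩ F).ncard - q) (S \ F).ncard : ℚ) := by
    intro S hS
    rw [hmem] at hS
    obtain ⟨hZS, hSE, -, -⟩ := hS
    rw [hM, modelMatroid_memCount_eq_mhat hE hF hqp hEcard hF2 hZF hZq hZS hSE]
  -- the type map
  set φ : Set α → ℕ × ℕ := fun S => ((S ∩ F).ncard - q, (S \ F).ncard) with hφ
  have hmaps : ∀ S ∈ Tfin, φ S ∈ Finset.range (m + 1) ×ˢ Finset.Ioo 0 k := by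
    intro S hS
    rw [hmem] at hS
    obtain ⟨hZS, hSE, h1, h2⟩ := hS
    simp only [hφ, Finset.mem_product, Finset.mem_range, Finset.mem_Ioo]
    have hSF : (S ∩ F).ncard ≤ F.ncard := Set.ncard_le_ncard inter_subset_right hFfin
    refine ⟨by omega, by omega, by omega⟩
  -- Step C/D: regroup by type
  have hfiber : ∀ a j, 0 < j → j < k → a ≤ m →
      (Tfin.filter (fun S => φ S = (a, j))).card = m.choose a * (q + k - m).choose j := by
    intro a j hj0 hjk ham
    have hset : ((Tfin.filter (fun S => φ S = (a, j)) : Finset (Set α)) : Set (Set α)) =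
        {S : Set α | Z ⊆ S ∧ S ⊆ E ∧ (S ∩ F).ncard = Z.ncard + a ∧ (S \ F).ncard = j} := by
      ext S
      rw [Finset.mem_coe, Finset.mem_filter, hmem, Set.mem_setOf_eq]
      simp only [hφ, Prod.mk.injEq]
      constructor
      · rintro ⟨⟨hZS, hSE, h1, h2⟩, ha, hj⟩
        have hq' : q ≤ (S ∩ F).ncard := by
          rw [← hZq]
          exact Set.ncard_le_ncard (subset_inter hZS hZF) ((hE.subset hSE).inter_of_left F)
        exact ⟨hZS, hSE, by omega, hj⟩
      · rintro ⟨hZS, hSE, ha, hj⟩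
        exact ⟨⟨hZS, hSE, by omega, by omega⟩, by omega, hj⟩
    rw [← Set.ncard_coe_finset, hset, ncard_index_sets_eq hE hF hZF a j, hZq, hN]
  calc @ruleQRecv α M _ (q + k) q Z = ∑ S ∈ Tfin, 1 / (memCount M (q + k) q S : ℚ) := hA
    _ = ∑ S ∈ Tfin, 1 / (mhat q m (φ S).1 (φ S).2 : ℚ) := by
        apply Finset.sum_congr rfl
        intro S hS
        rw [hB S hS]
    _ = ∑ y ∈ Finset.range (m + 1) ×ˢ Finset.Ioo 0 k, ∑ S ∈ Tfin.filter (fun S => φ S = y),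
          1 / (mhat q m (φ S).1 (φ S).2 : ℚ) := (Finset.sum_fiberwise_of_maps_to hmaps _).symm
    _ = ∑ y ∈ Finset.range (m + 1) ×ˢ Finset.Ioo 0 k,
          ((m.choose y.1 * (q + k - m).choose y.2 : ℕ) : ℚ) / (mhat q m y.1 y.2 : ℚ) := by
        apply Finset.sum_congr rfl
        rintro ⟨a, j⟩ hy
        rw [Finset.mem_product, Finset.mem_range, Finset.mem_Ioo] at hy
        rw [show (∑ S ∈ Tfin.filter (fun S => φ S = (a, j)), 1 / (mhat q m (φ S).1 (φ S).2 : ℚ))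
            = ∑ S ∈ Tfin.filter (fun S => φ S = (a, j)), 1 / (mhat q m a j : ℚ) from
          Finset.sum_congr rfl (fun S hS => by rw [(Finset.mem_filter.1 hS).2])]
        rw [Finset.sum_const, hfiber a j hy.2.1 hy.2.2 (by omega), nsmul_eq_mul]
        dsimp only
        push_cast
        ring
    _ = rhat q k m := by
        unfold rhat
        rw [Finset.sum_product_right]


/-- `#(Iio n) = n` in `ℕ`. -/
lemma ncard_Iio_nat (n : ℕ) : (Set.Iio n).ncard = n := by
  rw [← Finset.coe_range, Set.ncard_coe_finset, Finset.card_range]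

/-- **The model identity, as the Prop of RankLevelSetRuleQModel — PROVED**: realised on `ℕ` by `E = Iio (2q + k)`,
`F = Iio (q + m)`, `Z = Iio q`. -/
theorem modelRecvEq : ModelRecvEq := by
  intro q k m hq hk hm
  have hE : (Set.Iio (q + k + q) : Set ℕ).Finite := Set.finite_Iio _
  have hFE : Set.Iio (q + m) ⊆ Set.Iio (q + k + q) := Set.Iio_subset_Iio (by omega)
  have hZF : Set.Iio q ⊆ Set.Iio (q + m) := Set.Iio_subset_Iio (by omega)
  have hEcard : (Set.Iio (q + k + q) : Set ℕ).ncard = (q + k) + q := ncard_Iio_nat _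
  have hFcard : (Set.Iio (q + m) : Set ℕ).ncard = q + m := ncard_Iio_nat _
  have hZcard : (Set.Iio q : Set ℕ).ncard = q := ncard_Iio_nat _
  refine ⟨ℕ, modelMatroid hE (Set.Iio (q + m)) q (q + k), modelMatroid_finite hE _ _ _, Set.Iio q, ?_, ?_, ?_⟩
  · rw [modelMatroid_E, hEcard]
  · rw [modelMatroid_mem_cellMembers_iff hE hFE (by omega) hEcard]
    refine ⟨hZF.trans hFE, hZcard, ?_⟩
    rw [Set.inter_eq_left.2 hZF, hZcard, hFcard]
    omega
  · rw [modelMatroid_ruleQRecv_eq hE hFE hk hEcard (by rw [hFcard]; omega) (by rw [hFcard]; omega) hZF hZcard, hFcard,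
      Nat.add_sub_cancel_left]

/-- **Rule Q fails at the tight layer of the cell `(86, 72)` on an explicit finite matroid** — the unconditional kernel
refutation of Rule Q as a universal mechanism (with p4 g19's `rhat_lt_phiK_72_14_66`). -/
theorem not_ruleQUp_model :
    ∃ (α : Type) (M : Matroid α) (hf : M.Finite),
      M.E.ncard = (72 + 14) + 72 ∧ ¬ @RuleQUp α M hf (72 + 14) 72 :=
  not_ruleQUp_of_modelRecvEq modelRecvEq

end PercRepro
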